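import Mathlib
import HarnessLib

/-!
# `ZagierDilogarithmConjecture` (stmt-KontsevichZagierPeriods-10550) — line
`kummer-clausen-linearisation` (c3), cycle 2, stub `oct_prelims`: elementary facts about `ζ₈`

Preliminaries for the second formal five-term certificate (the octagonal relation
`9·D((1+2√2 i)/2) + 4·D((2+5√2 i)/4) = 8·(D(ζ₈) + D(ζ₈³))`, Bloch group of `ℚ(√−2)` inside
`ℚ(ζ₈)`). For `ζ = ζ₈ = exp(2πi/8)` we prove (`oct_prelims`):

* `conj ζ = ζ⁷` (`exp` commutes with conjugation, `exp(2πi) = 1`);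
* `ζ⁴ = −1` (`exp(πi) = −1`);
* `ζ + ζ³ = √2·i`: `s = ζ + ζ³` has `s² = ζ² + 2ζ⁴ + ζ⁶ = −2 = (√2·i)²`, and the sign is fixed by
  `Im s = sin(π/4) + sin(3π/4) > 0`;
* `Im ζ = sin(π/4) > 0`, `Im ζ³ = sin(3π/4) > 0`.

Sorry-free; Mathlib only; axioms ⊆ {propext, Classical.choice, Quot.sound}.

References: W. D. Neumann, *Hilbert's 3rd problem and invariants of 3-manifolds*, Geom. Topol.
Monogr. 1 (1998) 383–411, §2.1 [Neumann1998]; D. Zagier, Invent. Math. 83 (1986) 285–301, §4.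
-/

noncomputable section

open scoped ComplexConjugate

namespace Summit.KontsevichZagierPeriods.HyperbolicBloch.ZagierDilogarithmCertificate

/-- `ζ̄₈ = ζ₈⁷` for `ζ₈ = exp(2πi/8)`. [folklore] -/
theorem oct_prelims_conj : conj (Complex.exp (2 * Real.pi * Complex.I / 8)) =
    Complex.exp (2 * Real.pi * Complex.I / 8) ^ 7 := by
  rw [← Complex.exp_conj, ← Complex.exp_nat_mul, map_div₀, map_mul, map_mul, Complex.conj_ofReal,
    Complex.conj_I, map_ofNat, map_ofNat,
    show ((7 : ℕ) : ℂ) * (2 * Real.pi * Complex.I / 8) = 2 * Real.pi * Complex.I +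
      2 * Real.pi * -Complex.I / 8 by push_cast; ring, Complex.exp_add, Complex.exp_two_pi_mul_I,
    one_mul]

/-- `ζ₈⁴ = −1` for `ζ₈ = exp(2πi/8)` (`exp(πi) = −1`). [folklore] -/
theorem oct_prelims_pow_four : Complex.exp (2 * Real.pi * Complex.I / 8) ^ 4 = -1 := by
  rw [← Complex.exp_nat_mul,
    show ((4 : ℕ) : ℂ) * (2 * Real.pi * Complex.I / 8) = Real.pi * Complex.I by push_cast; ring,
    Complex.exp_pi_mul_I]

/-- Powers of `ζ₈ = exp(2πi/8)` as exponentials of a real multiple of `i`: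
`ζ₈ ^ k = exp((2πk/8)·i)`. [folklore] -/
theorem oct_prelims_pow_eq (k : ℕ) :
    Complex.exp (2 * Real.pi * Complex.I / 8) ^ k =
      Complex.exp (((2 * Real.pi * k / 8 : ℝ) : ℂ) * Complex.I) := by
  rw [← Complex.exp_nat_mul]
  congr 1
  push_cast
  ring

/-- Imaginary parts of the powers of `ζ₈ = exp(2πi/8)`: `Im ζ₈ ^ k = sin(2πk/8)`. [folklore] -/
theorem oct_prelims_pow_im (k : ℕ) :
    (Complex.exp (2 * Real.pi * Complex.I / 8) ^ k).im = Real.sin (2 * Real.pi * k / 8) := by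
  rw [oct_prelims_pow_eq, Complex.exp_ofReal_mul_I_im]

/-- `Im ζ₈ = sin(π/4) > 0` for `ζ₈ = exp(2πi/8)`. [folklore] -/
theorem oct_prelims_im_one_pos : 0 < (Complex.exp (2 * Real.pi * Complex.I / 8)).im := by
  have h := oct_prelims_pow_im 1
  rw [pow_one] at h
  rw [h]
  exact Real.sin_pos_of_pos_of_lt_pi (by positivity) (by push_cast; linarith [Real.pi_pos])

/-- `Im ζ₈³ = sin(3π/4) > 0` for `ζ₈ = exp(2πi/8)`. [folklore] -/
theorem oct_prelims_im_three_pos : 0 < (Complex.exp (2 * Real.pi * Complex.I / 8) ^ 3).im := by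
  rw [oct_prelims_pow_im]
  exact Real.sin_pos_of_pos_of_lt_pi (by positivity) (by push_cast; linarith [Real.pi_pos])

/-- `ζ₈ + ζ₈³ = √2·i` for `ζ₈ = exp(2πi/8)`: `(ζ₈ + ζ₈³)² = ζ₈² + 2ζ₈⁴ + ζ₈⁶ = −2 = (√2·i)²`
(using `ζ₈⁴ = −1`), and `Im(ζ₈ + ζ₈³) > 0` excludes the sign `−√2·i`. [folklore] -/
theorem oct_prelims_sum :
    Complex.exp (2 * Real.pi * Complex.I / 8) + Complex.exp (2 * Real.pi * Complex.I / 8) ^ 3 =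
      (Real.sqrt 2 : ℂ) * Complex.I := by
  have h4 := oct_prelims_pow_four
  have him : 0 < (Complex.exp (2 * Real.pi * Complex.I / 8) +
      Complex.exp (2 * Real.pi * Complex.I / 8) ^ 3).im := by
    rw [Complex.add_im]
    exact add_pos oct_prelims_im_one_pos oct_prelims_im_three_pos
  generalize Complex.exp (2 * Real.pi * Complex.I / 8) = ζ at h4 him ⊢
  have h2 : ((Real.sqrt 2 : ℂ) * Complex.I) ^ 2 = -2 := by
    rw [mul_pow, Complex.I_sq, ← Complex.ofReal_pow, Real.sq_sqrt (by norm_num)]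
    push_cast
    ring
  have hsq : (ζ + ζ ^ 3) ^ 2 = ((Real.sqrt 2 : ℂ) * Complex.I) ^ 2 := by
    rw [h2]
    linear_combination (ζ ^ 2 + 2) * h4
  rcases sq_eq_sq_iff_eq_or_eq_neg.1 hsq with h | h
  · exact h
  · exfalso
    have h' := congrArg Complex.im h
    rw [h'] at him
    simp only [Complex.neg_im, Complex.mul_im, Complex.ofReal_re, Complex.ofReal_im, Complex.I_re,
      Complex.I_im, mul_zero, mul_one, add_zero] at him
    have hs : 0 < Real.sqrt 2 := Real.sqrt_pos.2 (by norm_num)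
    linarith

/-- **Elementary facts about `ζ₈ = exp(2πi/8)`** used by the octagonal five-term certificate:
`conj ζ₈ = ζ₈⁷`, `ζ₈⁴ = −1`, `ζ₈ + ζ₈³ = √2·i`, `Im ζ₈ > 0`, `Im ζ₈³ > 0`. [folklore] -/
theorem oct_prelims :
    conj (Complex.exp (2 * Real.pi * Complex.I / 8)) = Complex.exp (2 * Real.pi * Complex.I / 8) ^ 7 ∧
    Complex.exp (2 * Real.pi * Complex.I / 8) ^ 4 = -1 ∧
    Complex.exp (2 * Real.pi * Complex.I / 8) + Complex.exp (2 * Real.pi * Complex.I / 8) ^ 3 =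
      (Real.sqrt 2 : ℂ) * Complex.I ∧
    0 < (Complex.exp (2 * Real.pi * Complex.I / 8)).im ∧
    0 < (Complex.exp (2 * Real.pi * Complex.I / 8) ^ 3).im :=
  ⟨oct_prelims_conj, oct_prelims_pow_four, oct_prelims_sum, oct_prelims_im_one_pos,
    oct_prelims_im_three_pos⟩

end Summit.KontsevichZagierPeriods.HyperbolicBloch.ZagierDilogarithmCertificate
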